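import Mathlib
import Literature.RingTheory.MvPolynomial.LinearFormsCoeff
import Summits.ValiantsHypothesis.ValiantsHypothesis.Theorems.RigidityForcesSymmetryRankRigidMinimalReprLaplaceFiveStarLemmaKEndgame

/-!
# ValiantsHypothesis / RigidityForcesSymmetry — crux `LaplaceOptimalFive` (stmt-ValiantsHypothesis-24813), crux idea
`young-shadow` (K1) on the star: **LEMMA K TOOLKIT — DIRECTIONAL DERIVATIVES AND THE INVARIANCE LEMMA**
(referee note `NOTE-crit3g5-24813-Lemma2prime-elementary.md` §B (b); memo `NOTE-p4g15-24813-K1-star.md` §14)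

The paper proves LEMMA K (b) in coordinates `y₀ = ℓ`.  The Lean route is coordinate-free: directional derivatives
`D_v F := Σ_a C(v_a) ∂_a F` along vectors `v` of the hyperplane `ker λ`.  This file supplies the calculus:

* `det3_sum_mid`, `det3_sum_last` — multilinearity: a family of vanishing `3 × 3` determinants stays zero after contracting a row
  with coefficients (any commutative ring);
* `dirDeriv_mul` (Leibniz), `dirDeriv_sum_smul_X` (`D_v (Σ l_z X_z) = C(v·l)`), `dirDeriv_comm` (`D_v D_w = D_w D_v`),
  `dirDeriv_isHomogeneous`;
* `dirDeriv_along_sub` — splitting `∂_a = D_{e_a − λ_a u} + λ_a D_u` with `u = e_{z₀}/λ_{z₀}`;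
* ★ `eq_C_mul_pow_of_dirDeriv_eq_zero` — the INVARIANCE LEMMA: a form `F` of degree `n` with `D_v F = 0` for every `v ∈ ker λ`
  (`λ_{z₀} ≠ 0`) is `c · L^n`, `L = Σ λ_z X_z` (induction on `n` via Euler's identity).

Pure algebra; no star hypotheses, no definitions, no `sorry`.  Honest framing: helper toward the Lean price (L2) of the K1-on-the-star
theorem (PAPER, referee PASS; not kernel); `LaplaceOptimalFive` OPEN · CONTESTED 72/120; `VP ≠ VNP` NOT proved.
-/

set_option linter.dupNamespace false

namespace Summit.ValiantsHypothesis.ValiantsHypothesis.Theorems.RigidityForcesSymmetryRankRigidMinimalRepr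

namespace LaplaceFiveStar

open Finset MvPolynomial

/-- Multilinearity in the MIDDLE row: if `det[(A,B,C₀); (k_b,l_b,q_b); (D,E,F)] = 0` for every `b`, then the determinant with middle
row `(Σ v_b k_b, Σ v_b l_b, Σ v_b q_b)` vanishes too (any commutative ring). [folklore] -/
theorem det3_sum_mid {R : Type*} [CommRing R] {ι : Type*} [Fintype ι] (A B C₀ D E F : R) (k l q v : ι → R)
    (h : ∀ b, A * (l b * F - E * q b) - k b * (B * F - E * C₀) + D * (B * q b - l b * C₀) = 0) :
    A * ((∑ b, v b * l b) * F - E * (∑ b, v b * q b)) - (∑ b, v b * k b) * (B * F - E * C₀)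
      + D * (B * (∑ b, v b * q b) - (∑ b, v b * l b) * C₀) = 0 := by
  have e : ∀ b, v b * (A * (l b * F - E * q b) - k b * (B * F - E * C₀) + D * (B * q b - l b * C₀))
      = (A * F - D * C₀) * (v b * l b) + (D * B - A * E) * (v b * q b) - (B * F - E * C₀) * (v b * k b) := fun b => by
    ring
  have hs : ∑ b, v b * (A * (l b * F - E * q b) - k b * (B * F - E * C₀) + D * (B * q b - l b * C₀)) = 0 :=
    Finset.sum_eq_zero fun b _ => by rw [h b, mul_zero]
  rw [Finset.sum_congr rfl fun b _ => e b, Finset.sum_sub_distrib, Finset.sum_add_distrib, ← Finset.mul_sum,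
    ← Finset.mul_sum, ← Finset.mul_sum] at hs
  linear_combination hs

/-- Multilinearity in the LAST row: if `det[(A,B,C₀); (D,E,F); (k_c,l_c,q_c)] = 0` for every `c`, then the determinant with last row
`(Σ w_c k_c, Σ w_c l_c, Σ w_c q_c)` vanishes too (any commutative ring). [folklore] -/
theorem det3_sum_last {R : Type*} [CommRing R] {ι : Type*} [Fintype ι] (A B C₀ D E F : R) (k l q w : ι → R)
    (h : ∀ c, A * (E * q c - l c * F) - D * (B * q c - l c * C₀) + k c * (B * F - E * C₀) = 0) :
    A * (E * (∑ c, w c * q c) - (∑ c, w c * l c) * F) - D * (B * (∑ c, w c * q c) - (∑ c, w c * l c) * C₀)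
      + (∑ c, w c * k c) * (B * F - E * C₀) = 0 := by
  have e : ∀ c, w c * (A * (E * q c - l c * F) - D * (B * q c - l c * C₀) + k c * (B * F - E * C₀))
      = (A * E - D * B) * (w c * q c) + (D * C₀ - A * F) * (w c * l c) + (B * F - E * C₀) * (w c * k c) := fun c => by
    ring
  have hs : ∑ c, w c * (A * (E * q c - l c * F) - D * (B * q c - l c * C₀) + k c * (B * F - E * C₀)) = 0 :=
    Finset.sum_eq_zero fun c _ => by rw [h c, mul_zero]
  rw [Finset.sum_congr rfl fun c _ => e c, Finset.sum_add_distrib, Finset.sum_add_distrib, ← Finset.mul_sum,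
    ← Finset.mul_sum, ← Finset.mul_sum] at hs
  linear_combination hs

/-- Leibniz rule for the directional derivative `D_v = Σ_a C(v_a) ∂_a`. [folklore] -/
theorem dirDeriv_mul (v : Fin 5 → ℂ) (F G : MvPolynomial (Fin 5) ℂ) :
    ∑ a : Fin 5, C (v a) * pderiv a (F * G)
      = (∑ a : Fin 5, C (v a) * pderiv a F) * G + F * ∑ a : Fin 5, C (v a) * pderiv a G := by
  simp only [pderiv_mul, mul_add, Finset.sum_add_distrib, Finset.sum_mul, Finset.mul_sum]
  congr 1
  · exact Finset.sum_congr rfl fun a _ => by ring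
  · exact Finset.sum_congr rfl fun a _ => by ring

/-- `D_v` of a linear form is the constant `C(v·l)`. [folklore] -/
theorem dirDeriv_sum_smul_X (v l : Fin 5 → ℂ) :
    ∑ a : Fin 5, C (v a) * pderiv a (∑ z : Fin 5, l z • (X z : MvPolynomial (Fin 5) ℂ)) = C (∑ a : Fin 5, v a * l a) := by
  classical
  rw [map_sum]
  exact Finset.sum_congr rfl fun a _ => by rw [pderiv_sum_smul_X, ← map_mul]

/-- `D_v` of a constant vanishes. [folklore] -/
theorem dirDeriv_C (v : Fin 5 → ℂ) (c : ℂ) :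
    ∑ a : Fin 5, C (v a) * pderiv a (C c : MvPolynomial (Fin 5) ℂ) = 0 :=
  Finset.sum_eq_zero fun a _ => by rw [pderiv_C, mul_zero]

/-- Directional derivatives commute: `D_v D_w F = D_w D_v F`. [folklore] -/
theorem dirDeriv_comm (v w : Fin 5 → ℂ) (F : MvPolynomial (Fin 5) ℂ) :
    ∑ a : Fin 5, C (v a) * pderiv a (∑ c : Fin 5, C (w c) * pderiv c F)
      = ∑ c : Fin 5, C (w c) * pderiv c (∑ a : Fin 5, C (v a) * pderiv a F) := by
  simp only [map_sum, pderiv_C_mul, Finset.mul_sum]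
  rw [Finset.sum_comm]
  exact Finset.sum_congr rfl fun c _ => Finset.sum_congr rfl fun a _ => by rw [pderiv_comm a c]; ring

/-- `D_v` is additive in the direction `v`. [folklore] -/
theorem dirDeriv_add_dir (v w : Fin 5 → ℂ) (F : MvPolynomial (Fin 5) ℂ) :
    ∑ a : Fin 5, C (v a + w a) * pderiv a F
      = (∑ a : Fin 5, C (v a) * pderiv a F) + ∑ a : Fin 5, C (w a) * pderiv a F := by
  rw [← Finset.sum_add_distrib]
  exact Finset.sum_congr rfl fun a _ => by rw [map_add, add_mul]

/-- `D_v` lowers the degree of a form by one. [folklore] -/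
theorem dirDeriv_isHomogeneous (v : Fin 5 → ℂ) {F : MvPolynomial (Fin 5) ℂ} {n : ℕ} (hF : F.IsHomogeneous n) :
    (∑ a : Fin 5, C (v a) * pderiv a F).IsHomogeneous (n - 1) :=
  IsHomogeneous.sum _ _ _ fun a _ => (hF.pderiv).C_mul (v a)

/-- A sum against a single-point coefficient: `Σ_b C(if b = a then c else 0) · f_b = C c · f_a`. [folklore] -/
theorem sum_C_ite_mul (a : Fin 5) (c : ℂ) (f : Fin 5 → MvPolynomial (Fin 5) ℂ) :
    ∑ b : Fin 5, C (if b = a then c else 0) * f b = C c * f a := by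
  rw [Finset.sum_eq_single a]
  · rw [if_pos rfl]
  · intro b _ hb
    rw [if_neg hb, C_0, zero_mul]
  · intro h
    exact absurd (Finset.mem_univ a) h

/-- Splitting `e_a = (e_a − λ_a u) + λ_a u` with `u = e_{z₀}/λ_{z₀}`:
`D_{e_a − λ_a u} F = ∂_a F − C(λ_a λ_{z₀}⁻¹) ∂_{z₀} F`. [folklore] -/
theorem dirDeriv_along_sub (lam : Fin 5 → ℂ) (z₀ a : Fin 5) (F : MvPolynomial (Fin 5) ℂ) :
    ∑ b : Fin 5, C ((if b = a then (1 : ℂ) else 0) - lam a * (if b = z₀ then (lam z₀)⁻¹ else 0)) * pderiv b F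
      = pderiv a F - C (lam a * (lam z₀)⁻¹) * pderiv z₀ F := by
  have e : ∀ b : Fin 5, C ((if b = a then (1 : ℂ) else 0) - lam a * (if b = z₀ then (lam z₀)⁻¹ else 0)) * pderiv b F
      = C (if b = a then (1 : ℂ) else 0) * pderiv b F - C (if b = z₀ then lam a * (lam z₀)⁻¹ else 0) * pderiv b F := by
    intro b
    rw [mul_ite, mul_zero, map_sub, sub_mul]
  rw [Finset.sum_congr rfl fun b _ => e b, Finset.sum_sub_distrib, sum_C_ite_mul, sum_C_ite_mul, C_1, one_mul]

/-- A form of degree `0` is a constant. [folklore] -/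
theorem eq_C_of_isHomogeneous_zero {F : MvPolynomial (Fin 5) ℂ} (hF : F.IsHomogeneous 0) : F = C (coeff 0 F) := by
  by_cases h0 : F = 0
  · rw [h0]; simp
  · exact totalDegree_eq_zero_iff_eq_C.mp (hF.totalDegree h0)

/-- **Invariance lemma.**  Let `λ_{z₀} ≠ 0`, `L = Σ λ_z X_z`.  A form `F` of degree `n` all of whose directional derivatives `D_v F`
along vectors `v` of the hyperplane `v·λ = 0` vanish is a constant multiple of `L^n`.  (Euler: `n F = Σ X_a ∂_a F = L · D_u F` with
`u = e_{z₀}/λ_{z₀}`, and `D_u F` inherits the hypothesis; induction on `n`.) [folklore] -/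
theorem eq_C_mul_pow_of_dirDeriv_eq_zero (lam : Fin 5 → ℂ) (z₀ : Fin 5) (hlam : lam z₀ ≠ 0) :
    ∀ (n : ℕ) (F : MvPolynomial (Fin 5) ℂ), F.IsHomogeneous n →
      (∀ v : Fin 5 → ℂ, ∑ a : Fin 5, v a * lam a = 0 → ∑ a : Fin 5, C (v a) * pderiv a F = 0) →
      ∃ c : ℂ, F = C c * (∑ z : Fin 5, lam z • (X z : MvPolynomial (Fin 5) ℂ)) ^ n := by
  classical
  intro n
  induction n with
  | zero =>
    intro F hF _
    exact ⟨coeff 0 F, by rw [pow_zero, mul_one]; exact eq_C_of_isHomogeneous_zero hF⟩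
  | succ n ih =>
    intro F hF hD
    -- `G := D_u F`, `u = e_{z₀}/λ_{z₀}`
    set u : Fin 5 → ℂ := fun b => if b = z₀ then (lam z₀)⁻¹ else 0 with hu
    set G : MvPolynomial (Fin 5) ℂ := ∑ b : Fin 5, C (u b) * pderiv b F with hG
    have hGh : G.IsHomogeneous n := by
      have h := dirDeriv_isHomogeneous u hF
      simpa using h
    have hGD : ∀ v : Fin 5 → ℂ, ∑ a : Fin 5, v a * lam a = 0 → ∑ a : Fin 5, C (v a) * pderiv a G = 0 := by
      intro v hv
      rw [hG, dirDeriv_comm v u F, hD v hv]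
      exact Finset.sum_eq_zero fun c _ => by rw [map_zero, mul_zero]
    obtain ⟨c', hc'⟩ := ih G hGh hGD
    -- `∂_a F = λ_a · G`
    have hpart : ∀ a : Fin 5, pderiv a F = C (lam a) * G := by
      intro a
      have hv : ∑ b : Fin 5, ((if b = a then (1 : ℂ) else 0) - lam a * u b) * lam b = 0 := by
        have e : ∀ b : Fin 5, ((if b = a then (1 : ℂ) else 0) - lam a * u b) * lam b
            = (if b = a then lam b else 0) - (if b = z₀ then lam a * ((lam z₀)⁻¹ * lam b) else 0) := by
          intro b
          simp only [hu]
          split_ifs <;> ring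
        rw [Finset.sum_congr rfl fun b _ => e b, Finset.sum_sub_distrib, Finset.sum_ite_eq', Finset.sum_ite_eq',
          if_pos (Finset.mem_univ _), if_pos (Finset.mem_univ _), inv_mul_cancel₀ hlam]
        ring
      have h := hD _ hv
      simp only [hu] at h
      rw [dirDeriv_along_sub lam z₀ a F, sub_eq_zero] at h
      rw [h, hG]
      simp only [hu]
      have e2 : ∀ b : Fin 5, C (if b = z₀ then (lam z₀)⁻¹ else 0) * pderiv b F
          = if b = z₀ then C ((lam z₀)⁻¹) * pderiv b F else 0 := by
        intro b
        split_ifs <;> simp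
      rw [Finset.sum_congr rfl fun b _ => e2 b, Finset.sum_ite_eq', if_pos (Finset.mem_univ _), ← mul_assoc, ← map_mul]
    -- Euler
    have heuler := hF.sum_X_mul_pderiv
    simp only [hpart] at heuler
    have hL : ∑ a : Fin 5, (X a : MvPolynomial (Fin 5) ℂ) * (C (lam a) * G)
        = (∑ z : Fin 5, lam z • (X z : MvPolynomial (Fin 5) ℂ)) * G := by
      rw [Finset.sum_mul]
      exact Finset.sum_congr rfl fun a _ => by rw [smul_eq_C_mul]; ring
    rw [hL, hc'] at heuler
    refine ⟨c' / (n + 1 : ℕ), ?_⟩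
    have hn' : ((n + 1 : ℕ) : ℂ) ≠ 0 := by exact_mod_cast Nat.succ_ne_zero n
    have hn : ((n + 1 : ℕ) : MvPolynomial (Fin 5) ℂ) ≠ 0 := by exact_mod_cast Nat.succ_ne_zero n
    have hC : ((n + 1 : ℕ) : MvPolynomial (Fin 5) ℂ) * C (c' / (n + 1 : ℕ)) = C c' := by
      rw [← map_natCast C, ← map_mul, mul_div_cancel₀ _ hn']
    apply mul_left_cancel₀ hn
    rw [← nsmul_eq_mul, ← heuler, ← hC]
    ring

end LaplaceFiveStar

end Summit.ValiantsHypothesis.ValiantsHypothesis.Theorems.RigidityForcesSymmetryRankRigidMinimalRepr
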